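import Literature.Probability.LatticeModels.PlanarIsing
import Literature.Probability.LatticeModels.TorusZeroMode
import HarnessLib

/-!
# Lattice translations of discretised domains and of the discrete `+` correlations

The discretisation scheme `Ω ↦ Ω_δ = meshDomain Ω δ` of `DomainDiscretisation.lean` and the discrete
critical `+` correlations `meshIsingPlusCorr Ω δ a = 𝔼⁺_{Ω_δ}[σ_{a₁}⋯σ_{aₙ}]` of `PlanarIsing.lean`
are **covariant under translations of the plane by lattice vectors** `u = δ v`, `v ∈ ℤ²`: the mesh
vertices, the mesh graph, the discrete domain (largest component), its boundary and the `+`-volume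
of the translated domain `u +ᵥ Ω` are the translates by `v` of those of `Ω`
(`mem_meshVertices_vadd`, `meshGraph_adj_vadd`, `mem_meshDomain_vadd`, `mem_meshBoundary_vadd`,
`meshInteriorFinset_vadd`), the marked sites move with them (`nearestSite_add_meshPoint`), and hence

* `meshIsingPlusCorr_vadd`: `𝔼⁺_{(δv + Ω)_δ}[σ_{a₁ + δv} ⋯ σ_{aₙ + δv}] = 𝔼⁺_{Ω_δ}[σ_{a₁} ⋯ σ_{aₙ}]`
  (transport of the finite-volume `+` measure along the graph isomorphism `x ↦ x + v`,
  `isingExpect_plus_map` of `TorusZeroMode.lean`; Friedli–Velenik 2017, §3.1 and proof of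
  Prop. 3.29: `⟨σ_i⟩⁺_{i+B(k)} = ⟨σ_0⟩⁺_{B(k)}`).

Only lattice vectors act: a translate of `Ω` by a vector that is *not* in `δℤ²` is discretised by a
genuinely different set of sites. This elementary bookkeeping is the mechanism behind the
scale-dependent behaviour of the fixed scheme exploited in `PlanarIsingRationalSlit.lean`
(a slit at height `1/2` is a lattice translate of an axis slit exactly at the meshes `δ = 1/(2m)`).

## References

* S. Friedli, Y. Velenik, *Statistical Mechanics of Lattice Systems*, CUP 2017, §3.1 (finite-volume
  Gibbs measures only depend on the graph structure; translation covariance, proof of Prop. 3.29).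
* D. Chelkak, C. Hongler, K. Izyurov, Ann. of Math. 181 (2015), §1.2 (the discretisation `Ω_δ`).
-/

noncomputable section

open scoped Pointwise
open Filter Topology
open Literature.Probability.LatticeModels

namespace Literature.Probability.LatticeModels

variable {Ω : Set ℂ} {δ : ℝ}

/-! ### Mesh points and rounding under lattice translations -/

/-- `Site.toComplex` commutes with subtraction (local copy). [folklore] -/
private theorem toComplex_sub' (x y : Site 2) :
    Site.toComplex (x - y) = Site.toComplex x - Site.toComplex y :=
  Complex.ext (by simp) (by simp)

/-- Mesh points commute with subtraction: `δ(x - y) = δx - δy` (local copy of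
`SupercriticalSAW.meshPoint_sub` of the Barriers tree, not imported here). [folklore] -/
private theorem meshPoint_sub_site (δ : ℝ) (x y : Site 2) :
    meshPoint δ (x - y) = meshPoint δ x - meshPoint δ y := by
  simp only [meshPoint, toComplex_sub', mul_sub]

/-- `δ(-v) = -δv`. [folklore] -/
private theorem meshPoint_neg_site (δ : ℝ) (v : Site 2) : meshPoint δ (-v) = -meshPoint δ v :=
  Complex.ext (by simp) (by simp)

/-- Rounding is covariant under lattice translations: `[(z + δv)/δ] = [z/δ] + v` (`δ ≠ 0`).
(Chelkak–Hongler–Izyurov 2015, §1.2, `[a/δ]`.) [folklore] -/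
theorem nearestSite_add_meshPoint (hδ : δ ≠ 0) (z : ℂ) (v : Site 2) :
    nearestSite δ (z + meshPoint δ v) = nearestSite δ z + v := by
  ext i
  fin_cases i
  · show round ((z + meshPoint δ v).re / δ) = round (z.re / δ) + v 0
    rw [Complex.add_re, meshPoint_re, add_div, mul_div_cancel_left₀ _ hδ, round_add_intCast]
  · show round ((z + meshPoint δ v).im / δ) = round (z.im / δ) + v 1
    rw [Complex.add_im, meshPoint_im, add_div, mul_div_cancel_left₀ _ hδ, round_add_intCast]

/-! ### Vertices and edges of the translated domain -/

/-- The mesh vertices of `δv + Ω` are the translates by `v` of those of `Ω`. [folklore] -/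
theorem mem_meshVertices_vadd {v x : Site 2} :
    x ∈ meshVertices (meshPoint δ v +ᵥ Ω) δ ↔ x - v ∈ meshVertices Ω δ := by
  rw [mem_meshVertices_iff, mem_meshVertices_iff, Set.mem_vadd_set_iff_neg_vadd_mem, vadd_eq_add,
    neg_add_eq_sub, meshPoint_sub_site]

/-- A closed mesh edge lies in the closure of `δv + Ω` iff its translate by `-v` lies in `Ω̄`.
[folklore] -/
theorem segment_subset_closure_vadd_iff {v x y : Site 2} :
    segment ℝ (meshPoint δ x) (meshPoint δ y) ⊆ closure (meshPoint δ v +ᵥ Ω) ↔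
      segment ℝ (meshPoint δ (x - v)) (meshPoint δ (y - v)) ⊆ closure Ω := by
  have hx : meshPoint δ x = meshPoint δ v + meshPoint δ (x - v) := by
    rw [meshPoint_sub_site]; ring
  have hy : meshPoint δ y = meshPoint δ v + meshPoint δ (y - v) := by
    rw [meshPoint_sub_site]; ring
  rw [hx, hy, ← segment_translate_image ℝ (meshPoint δ v), closure_vadd]
  have himg : meshPoint δ v +ᵥ closure Ω = (fun z => meshPoint δ v + z) '' closure Ω := by
    rw [← Set.image_vadd]; rfl
  rw [himg, Set.image_subset_image_iff (add_right_injective _)]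

/-- The mesh graph of `δv + Ω` is the translate by `v` of the mesh graph of `Ω`. [folklore] -/
theorem meshGraph_adj_vadd {v x y : Site 2} :
    (meshGraph (meshPoint δ v +ᵥ Ω) δ).Adj x y ↔ (meshGraph Ω δ).Adj (x - v) (y - v) := by
  rw [meshGraph_adj_iff, meshGraph_adj_iff, segment_subset_closure_vadd_iff]
  have hadj : (zdGraph 2).Adj x y ↔ (zdGraph 2).Adj (x - v) (y - v) := by
    rw [← zdGraph_adj_shift_iff v (x - v) (y - v)]
    simp
  rw [hadj]

/-- Translation by `v` maps mesh vertices of `Ω` to mesh vertices of `δv + Ω`. [folklore] -/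
theorem mapsTo_shift_meshVertices (Ω : Set ℂ) (δ : ℝ) (v : Site 2) :
    Set.MapsTo (Site.shift v) (meshVertices Ω δ) (meshVertices (meshPoint δ v +ᵥ Ω) δ) := by
  intro x hx
  rw [Site.shift_apply, mem_meshVertices_vadd]
  simpa using hx

/-- Reachability in the mesh vertex graph is transported by lattice translations (one direction):
translation by `v` is a graph homomorphism of the mesh graphs (`meshGraph_adj_vadd`) mapping mesh
vertices to mesh vertices, hence induces a homomorphism of the mesh vertex graphs
(`SimpleGraph.induceHom`), and reachability is pushed forward along homomorphisms. [folklore] -/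
theorem reachable_vadd_of_reachable {v x y : Site 2} (hx : x ∈ meshVertices Ω δ)
    (hy : y ∈ meshVertices Ω δ) (h : (meshVertexGraph Ω δ).Reachable ⟨x, hx⟩ ⟨y, hy⟩) :
    (meshVertexGraph (meshPoint δ v +ᵥ Ω) δ).Reachable
      ⟨x + v, mapsTo_shift_meshVertices Ω δ v hx⟩ ⟨y + v, mapsTo_shift_meshVertices Ω δ v hy⟩ :=
  h.map (SimpleGraph.induceHom (G' := meshGraph (meshPoint δ v +ᵥ Ω) δ)
    ⟨Site.shift v, fun hxy => by rw [meshGraph_adj_vadd]; simpa using hxy⟩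
    (mapsTo_shift_meshVertices Ω δ v))

/-- Reachability statements in the mesh vertex graph can be transported along an equality of
domains. [folklore] -/
theorem reachable_congr_set {Ω₁ Ω₂ : Set ℂ} (h : Ω₁ = Ω₂) {x y : Site 2} (hx : x ∈ meshVertices Ω₁ δ)
    (hy : y ∈ meshVertices Ω₁ δ) :
    (meshVertexGraph Ω₁ δ).Reachable ⟨x, hx⟩ ⟨y, hy⟩ ↔
      (meshVertexGraph Ω₂ δ).Reachable ⟨x, h ▸ hx⟩ ⟨y, h ▸ hy⟩ := by
  subst h
  rfl

/-- Translating by `v` and then by `-v` gives back `Ω`. [folklore] -/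
theorem neg_meshPoint_vadd_vadd (Ω : Set ℂ) (δ : ℝ) (v : Site 2) :
    meshPoint δ (-v) +ᵥ (meshPoint δ v +ᵥ Ω) = Ω := by
  rw [meshPoint_neg_site, neg_vadd_vadd]

/-- Reachability in the mesh vertex graph is transported by lattice translations. [folklore] -/
theorem reachable_vadd_iff {v x y : Site 2} (hx : x ∈ meshVertices (meshPoint δ v +ᵥ Ω) δ)
    (hy : y ∈ meshVertices (meshPoint δ v +ᵥ Ω) δ) :
    (meshVertexGraph (meshPoint δ v +ᵥ Ω) δ).Reachable ⟨x, hx⟩ ⟨y, hy⟩ ↔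
      (meshVertexGraph Ω δ).Reachable ⟨x - v, mem_meshVertices_vadd.1 hx⟩
        ⟨y - v, mem_meshVertices_vadd.1 hy⟩ := by
  constructor
  · intro h
    have h' := reachable_vadd_of_reachable (v := -v) hx hy h
    rw [reachable_congr_set (neg_meshPoint_vadd_vadd Ω δ v)] at h'
    convert h' using 2 <;> simp [sub_eq_add_neg]
  · intro h
    have h' := reachable_vadd_of_reachable (v := v) _ _ h
    convert h' using 2 <;> simp

/-! ### The discrete domain (largest component) of the translated domain -/

/-- The support of the connected component of a mesh vertex `x`, as a set of sites, is the set of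
mesh vertices reachable from `x`. [folklore] -/
theorem mem_image_supp_iff {x : Site 2} (hx : x ∈ meshVertices Ω δ) {z : Site 2} :
    z ∈ Subtype.val '' ((meshVertexGraph Ω δ).connectedComponentMk ⟨x, hx⟩).supp ↔
      ∃ hz : z ∈ meshVertices Ω δ, (meshVertexGraph Ω δ).Reachable ⟨x, hx⟩ ⟨z, hz⟩ := by
  constructor
  · rintro ⟨⟨z, hz⟩, hmem, rfl⟩
    rw [SimpleGraph.ConnectedComponent.mem_supp_iff, SimpleGraph.ConnectedComponent.eq] at hmem
    exact ⟨hz, hmem.symm⟩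
  · rintro ⟨hz, h⟩
    refine ⟨⟨z, hz⟩, ?_, rfl⟩
    rw [SimpleGraph.ConnectedComponent.mem_supp_iff, SimpleGraph.ConnectedComponent.eq]
    exact h.symm

/-- **The discrete domain in terms of component sizes.** A site belongs to `Ω_δ = meshDomain Ω δ`
iff it is a mesh vertex whose connected component has maximal size (Smirnov 2001, §2: "the largest
connected component"; this is the definition unfolded). [folklore] -/
theorem mem_meshDomain_iff_ncard {x : Site 2} :
    x ∈ meshDomain Ω δ ↔ ∃ hx : x ∈ meshVertices Ω δ, ∀ (y : Site 2) (hy : y ∈ meshVertices Ω δ),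
      ((meshVertexGraph Ω δ).connectedComponentMk ⟨y, hy⟩).supp.ncard ≤
        ((meshVertexGraph Ω δ).connectedComponentMk ⟨x, hx⟩).supp.ncard := by
  simp only [meshDomain, Set.mem_iUnion, Set.mem_image, Subtype.exists, exists_and_right,
    exists_eq_right]
  constructor
  · rintro ⟨C, hC, hx, hxC⟩
    refine ⟨hx, fun y hy => ?_⟩
    have hCx : (meshVertexGraph Ω δ).connectedComponentMk ⟨x, hx⟩ = C :=
      (SimpleGraph.ConnectedComponent.mem_supp_iff _ _).1 hxC
    rw [hCx]
    exact hC _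
  · rintro ⟨hx, h⟩
    refine ⟨(meshVertexGraph Ω δ).connectedComponentMk ⟨x, hx⟩, ?_, hx, rfl⟩
    intro C'
    induction C' using SimpleGraph.ConnectedComponent.ind with
    | h y => exact h y y.2

/-- The support of the component of a vertex of the translated domain is the translate of the
support of the component of the translated-back vertex. [folklore] -/
theorem image_supp_vadd {v x : Site 2} (hx : x ∈ meshVertices (meshPoint δ v +ᵥ Ω) δ) :
    Subtype.val '' ((meshVertexGraph (meshPoint δ v +ᵥ Ω) δ).connectedComponentMk ⟨x, hx⟩).supp =
      (fun z => z + v) '' (Subtype.val ''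
        ((meshVertexGraph Ω δ).connectedComponentMk ⟨x - v, mem_meshVertices_vadd.1 hx⟩).supp) := by
  ext z
  rw [mem_image_supp_iff, Set.mem_image]
  constructor
  · rintro ⟨hz, h⟩
    refine ⟨z - v, (mem_image_supp_iff _).2 ⟨mem_meshVertices_vadd.1 hz, ?_⟩, sub_add_cancel z v⟩
    exact (reachable_vadd_iff hx hz).1 h
  · rintro ⟨w, hw, rfl⟩
    obtain ⟨hw, h⟩ := (mem_image_supp_iff _).1 hw
    have hw' : w + v ∈ meshVertices (meshPoint δ v +ᵥ Ω) δ :=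
      mem_meshVertices_vadd.2 (by simpa using hw)
    refine ⟨hw', ?_⟩
    rw [reachable_vadd_iff hx hw']
    convert h using 2
    simp

/-- Component sizes are invariant under lattice translations. [folklore] -/
theorem ncard_supp_vadd {v x : Site 2} (hx : x ∈ meshVertices (meshPoint δ v +ᵥ Ω) δ) :
    ((meshVertexGraph (meshPoint δ v +ᵥ Ω) δ).connectedComponentMk ⟨x, hx⟩).supp.ncard =
      ((meshVertexGraph Ω δ).connectedComponentMk
        ⟨x - v, mem_meshVertices_vadd.1 hx⟩).supp.ncard := by
  rw [← Set.ncard_image_of_injective _ Subtype.val_injective, image_supp_vadd hx,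
    Set.ncard_image_of_injective _ (add_left_injective v),
    Set.ncard_image_of_injective _ Subtype.val_injective]

/-- **The discrete domain of a lattice translate**: `(δv + Ω)_δ = Ω_δ + v`. [folklore] -/
theorem mem_meshDomain_vadd {v x : Site 2} :
    x ∈ meshDomain (meshPoint δ v +ᵥ Ω) δ ↔ x - v ∈ meshDomain Ω δ := by
  rw [mem_meshDomain_iff_ncard, mem_meshDomain_iff_ncard]
  constructor
  · rintro ⟨hx, h⟩
    refine ⟨mem_meshVertices_vadd.1 hx, fun y hy => ?_⟩
    have hy' : y + v ∈ meshVertices (meshPoint δ v +ᵥ Ω) δ :=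
      mem_meshVertices_vadd.2 (by simpa using hy)
    have := h (y + v) hy'
    rw [ncard_supp_vadd hy', ncard_supp_vadd hx] at this
    convert this using 3
    simp
  · rintro ⟨hx, h⟩
    have hx' : x ∈ meshVertices (meshPoint δ v +ᵥ Ω) δ := mem_meshVertices_vadd.2 hx
    refine ⟨hx', fun y hy => ?_⟩
    rw [ncard_supp_vadd hy, ncard_supp_vadd hx']
    exact h (y - v) _

/-- The graph `Ω_δ` of a lattice translate is the translated graph. [folklore] -/
theorem discreteDomainGraph_adj_vadd {v x y : Site 2} :
    (discreteDomainGraph (meshPoint δ v +ᵥ Ω) δ).Adj x y ↔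
      (discreteDomainGraph Ω δ).Adj (x - v) (y - v) := by
  rw [discreteDomainGraph_adj_iff, discreteDomainGraph_adj_iff, meshGraph_adj_vadd,
    mem_meshDomain_vadd, mem_meshDomain_vadd]

/-- The discrete boundary of a lattice translate is the translated discrete boundary. [folklore] -/
theorem mem_meshBoundary_vadd {v x : Site 2} :
    x ∈ meshBoundary (meshPoint δ v +ᵥ Ω) δ ↔ x - v ∈ meshBoundary Ω δ := by
  rw [mem_meshBoundary_iff, mem_meshBoundary_iff, mem_meshDomain_vadd]
  refine and_congr_right fun _ => ⟨?_, ?_⟩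
  · rintro ⟨y, hy, hn⟩
    refine ⟨y - v, ?_, fun h => hn (discreteDomainGraph_adj_vadd.2 h)⟩
    rw [← zdGraph_adj_shift_iff v]
    simpa using hy
  · rintro ⟨y, hy, hn⟩
    refine ⟨y + v, ?_, fun h => hn ?_⟩
    · rw [← zdGraph_adj_shift_iff v] at hy
      simpa using hy
    · have := discreteDomainGraph_adj_vadd.1 h
      simpa using this

/-- Boundedness is invariant under translations. [folklore] -/
theorem isBounded_vadd_iff (u : ℂ) (Ω : Set ℂ) :
    Bornology.IsBounded (u +ᵥ Ω) ↔ Bornology.IsBounded Ω := by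
  refine ⟨fun h => ?_, fun h => h.vadd u⟩
  have := h.vadd (-u)
  rwa [neg_vadd_vadd] at this

/-- **The `+`-volume of a lattice translate** is the translated `+`-volume:
`(δv + Ω)_δ ∖ ∂(δv + Ω)_δ = (Ω_δ ∖ ∂Ω_δ) + v`. [folklore] -/
theorem meshInteriorFinset_vadd (Ω : Set ℂ) (δ : ℝ) (v : Site 2) :
    meshInteriorFinset (meshPoint δ v +ᵥ Ω) δ =
      (meshInteriorFinset Ω δ).map (Site.shift v).toEmbedding := by
  classical
  ext x
  simp only [Finset.mem_map_equiv, Site.shift_symm_apply]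
  unfold meshInteriorFinset
  by_cases h : Bornology.IsBounded Ω ∧ 0 < δ
  · have h' : Bornology.IsBounded (meshPoint δ v +ᵥ Ω) ∧ 0 < δ := ⟨h.1.vadd _, h.2⟩
    rw [dif_pos h', dif_pos h]
    simp only [Finset.mem_filter, Set.Finite.mem_toFinset]
    rw [mem_meshDomain_vadd, mem_meshBoundary_vadd]
  · have h' : ¬ (Bornology.IsBounded (meshPoint δ v +ᵥ Ω) ∧ 0 < δ) := fun h' =>
      h ⟨(isBounded_vadd_iff _ _).1 h'.1, h'.2⟩
    rw [dif_neg h', dif_neg h]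
    simp

/-! ### Translation covariance of the discrete `+` correlations -/

/-- **Lattice-translation covariance of the discrete critical `+` correlations.** For a lattice
vector `u = δv`, `v ∈ ℤ²` (`δ ≠ 0`),
`𝔼⁺_{(u + Ω)_δ}[σ_{a₁+u} ⋯ σ_{aₙ+u}] = 𝔼⁺_{Ω_δ}[σ_{a₁} ⋯ σ_{aₙ}]`: the discretisation of `u + Ω` is
the translate by `v` of that of `Ω` (`meshInteriorFinset_vadd`, `discreteDomainGraph_adj_vadd`), the
marked sites move by `v` (`nearestSite_add_meshPoint`), and the finite-volume `+` measure is
transported along the graph isomorphism `x ↦ x + v` (`isingExpect_plus_map`; Friedli–Velenik 2017,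
§3.1, proof of Prop. 3.29). [cite: FriedliVelenik2017, §3.1 and proof of Prop. 3.29 (translation covariance of finite-volume + measures)] -/
theorem meshIsingPlusCorr_vadd (hδ : δ ≠ 0) (v : Site 2) {n : ℕ} (a : Fin n → ℂ) :
    meshIsingPlusCorr (meshPoint δ v +ᵥ Ω) δ (fun i => a i + meshPoint δ v) =
      meshIsingPlusCorr Ω δ a := by
  classical
  unfold meshIsingPlusCorr
  rw [meshInteriorFinset_vadd]
  have hsite : (fun i => nearestSite δ (a i + meshPoint δ v)) =
      fun i => (Site.shift v).toEmbedding (nearestSite δ (a i)) := by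
    funext i
    rw [nearestSite_add_meshPoint hδ]
    rfl
  rw [hsite]
  have hadj : ∀ x ∈ meshInteriorFinset Ω δ, ∀ y,
      ((discreteDomainGraph (meshPoint δ v +ᵥ Ω) δ).Adj ((Site.shift v).toEmbedding x)
          ((Site.shift v).toEmbedding y) ↔ (discreteDomainGraph Ω δ).Adj x y) := by
    intro x _ y
    show (discreteDomainGraph (meshPoint δ v +ᵥ Ω) δ).Adj (x + v) (y + v) ↔ _
    rw [discreteDomainGraph_adj_vadd]
    simp
  have hnb : ∀ x ∈ meshInteriorFinset Ω δ, ∀ y',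
      (discreteDomainGraph (meshPoint δ v +ᵥ Ω) δ).Adj ((Site.shift v).toEmbedding x) y' →
        ∃ y, (Site.shift v).toEmbedding y = y' :=
    fun x _ y' _ => ⟨y' - v, by simp⟩
  rw [isingExpect_plus_map (G := discreteDomainGraph Ω δ)
    (G' := discreteDomainGraph (meshPoint δ v +ᵥ Ω) δ) (Site.shift v).toEmbedding hadj hnb
    criticalBetaTwo 0 (measurable_spinMonomial _)]
  congr 1
  funext σ
  simp only [spinMonomial, spinAt_extendAlong]

end Literature.Probability.LatticeModels
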